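import Summits.Langlands.Langlands.Theses.RootDecomp1

/-!
# Glue of the layer-2 split of `SemisimpleAvatar` (route RootDecomp1, rev 4)

Closes the glue item `stmt-Langlands-29153` of `route-Langlands-RootDecomp1`:
`SemisimpleAvatar_of_split : DarkPrimitiveAvatars → AccessibleAvatars → AvatarDescent →
RestrictionTwistTransport → InductionTransport → DualTransport → SemisimpleAvatar`.
Pure logic — excluded middle on the (inlined, impredicative) dial «`π` is special», i.e. `π` lies in
every class of automorphic representations that contains all representations over base fields of
archimedean defect `[K : K⁺] ≤ 2` and is closed under twisted restriction along a finite layer, weak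
base-change descent, automorphic induction and duals.  On the special side, MINIMALITY of that least
saturated class is applied to the class «cuspidal L-algebraic members have semisimple `ℓ`-adic avatars»,
which is saturated precisely by the five pieces (accessible fields, up-transport, descent, induction,
duals); on the non-special side `DarkPrimitiveAvatars` applies verbatim.  This is the lens-6 node proof
`AIDefectCarving` split glue (decomp-langlands, 2026-08-30; certified against a mock render and, by the
critic, against the route of record), transported to the tree's declarations.  No definitions, no new
mathematics.
-/

set_option linter.dupNamespace false -- project-wide option; `Summit.Langlands.Langlands` is the mandated namespace

namespace Summit.Langlands.Langlands.Theorems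

open scoped Classical
open Filter
open Summit.Langlands.Langlands.Theses

/-- The glue item `stmt-Langlands-29153` of route RootDecomp1 (rev 4): the six children
`DarkPrimitiveAvatars` (G), `AccessibleAvatars` (Acc), `AvatarDescent` (AvDesc), `RestrictionTwistTransport`
(RTT), `InductionTransport` (AIT) and `DualTransport` (DT) of the split of `SemisimpleAvatar` (E) imply the
parent.  Proof: by cases on the inlined predicate «`π` is special»; if special, apply its defining minimality
to the class `S K n hcpt π := (π cuspidal, L-algebraic ⇒ semisimple avatars at every ℓ, ι)`, whose five
closure properties are exactly Acc, RTT, AvDesc, AIT, DT; if not special, G applies. -/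
theorem SemisimpleAvatar_of_split_proof :
    Summit.Langlands.Langlands.Theses.RootDecomp1.SemisimpleAvatar_of_split := by
  intro hG hAcc hD hT hI hV K _ _ n hcpt hn π hπ ℓ _ ι
  by_cases hsp : (∀ S : (∀ (K : Type) [Field K] [NumberField K] (n : ℕ) (hcpt : Literature.NumberTheory.Automorphic.isCompact_glFiniteIntegralLevel n K), Literature.NumberTheory.Automorphic.AutomorphicRepData (Literature.NumberTheory.Automorphic.AutomorphyDatum.gl n K hcpt) → Prop), ((∀ (K : Type) [Field K] [NumberField K] (n : ℕ) (hcpt : Literature.NumberTheory.Automorphic.isCompact_glFiniteIntegralLevel n K) (π : Literature.NumberTheory.Automorphic.AutomorphicRepData (Literature.NumberTheory.Automorphic.AutomorphyDatum.gl n K hcpt)), Module.finrank (NumberField.maximalRealSubfield K) K ≤ 2 → S K n hcpt π) ∧ (∀ (K₀ : Type) [Field K₀] [NumberField K₀] (M : Type) [Field M] [NumberField M] [Algebra K₀ M] (n : ℕ) (h₀ : Literature.NumberTheory.Automorphic.isCompact_glFiniteIntegralLevel n K₀) (hM : Literature.NumberTheory.Automorphic.isCompact_glFiniteIntegralLevel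 n M) (h₁ : Literature.NumberTheory.Automorphic.isCompact_glFiniteIntegralLevel 1 M) (π₀ : Literature.NumberTheory.Automorphic.CuspidalAutomorphicRepData n K₀ h₀) (χ : Literature.NumberTheory.Automorphic.AutomorphicRepData (Literature.NumberTheory.Automorphic.AutomorphyDatum.gl 1 M h₁)) (P : Literature.NumberTheory.Automorphic.AutomorphicRepData (Literature.NumberTheory.Automorphic.AutomorphyDatum.gl n M hM)), π₀.1.IsLAlgebraic → χ.IsLAlgebraic → (∀ᶠ w : IsDedekindDomain.HeightOneSpectrum (NumberField.RingOfIntegers M) in cofinite, ∀ (u : IsDedekindDomain.HeightOneSpectrum (NumberField.RingOfIntegers K₀)) (α : Multiset ℂ) (c : ℂ), w.asIdeal.under (NumberField.RingOfIntegers K₀) = u.asIdeal → π₀.1.HasSatakeParamAt u α → χ.HasSatakeParamAt w {c} → P.HasSatakeParamAt w ((α.map (· ^ w.asIdeal.inertiaDeg (NumberField.RingOfIntegers K₀))).map (c * ·))) → S K₀ n h₀ π₀.1 → S M n hM P) ∧ (∀ (K : Type) [Field K] [NumberField K] (M : Type) [Field M] [NumberField M] [Algebra K M] (n : ℕ) (hcpt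 : Literature.NumberTheory.Automorphic.isCompact_glFiniteIntegralLevel n K) (hM : Literature.NumberTheory.Automorphic.isCompact_glFiniteIntegralLevel n M) (π : Literature.NumberTheory.Automorphic.AutomorphicRepData (Literature.NumberTheory.Automorphic.AutomorphyDatum.gl n K hcpt)) (P : Literature.NumberTheory.Automorphic.CuspidalAutomorphicRepData n M hM), P.1.IsLAlgebraic → Literature.NumberTheory.Automorphic.IsWeakBaseChangeLiftAE π P.1 → S M n hM P.1 → S K n hcpt π) ∧ (∀ (K : Type) [Field K] [NumberField K] (L : Type) [Field L] [NumberField L] [Algebra K L] (m n : ℕ) (hL : Literature.NumberTheory.Automorphic.isCompact_glFiniteIntegralLevel m L) (hcpt : Literature.NumberTheory.Automorphic.isCompact_glFiniteIntegralLevel n K) (σ : Literature.NumberTheory.Automorphic.CuspidalAutomorphicRepData m L hL) (π : Literature.NumberTheory.Automorphic.AutomorphicRepData (Literature.NumberTheory.Automorphic.AutomorphyDatum.gl n K hcpt)), 0 < m → σ.1.IsLAlgebraic → (∀ᶠ v : IsDedekindDomain.HeightOneSpectrum (NumberField.RingOfIntegers K) in cofinite, ∀ β : IsDedekindDomain.HeightOneSpectrum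 (NumberField.RingOfIntegers L) → Multiset ℂ, (∀ w : IsDedekindDomain.HeightOneSpectrum (NumberField.RingOfIntegers L), w.asIdeal.under (NumberField.RingOfIntegers K) = v.asIdeal → σ.1.HasSatakeParamAt w (β w)) → ∃ α : Multiset ℂ, π.HasSatakeParamAt v α ∧ Literature.NumberTheory.Automorphic.satakePolynomial α = ∏ᶠ w ∈ {w : IsDedekindDomain.HeightOneSpectrum (NumberField.RingOfIntegers L) | w.asIdeal.under (NumberField.RingOfIntegers K) = v.asIdeal}, (Literature.NumberTheory.Automorphic.satakePolynomial (β w)).comp (Polynomial.X ^ w.asIdeal.inertiaDeg (NumberField.RingOfIntegers K))) → S L m hL σ.1 → S K n hcpt π) ∧ (∀ (K : Type) [Field K] [NumberField K] (n : ℕ) (hcpt : Literature.NumberTheory.Automorphic.isCompact_glFiniteIntegralLevel n K) (π : Literature.NumberTheory.Automorphic.CuspidalAutomorphicRepData n K hcpt) (P : Literature.NumberTheory.Automorphic.AutomorphicRepData (Literature.NumberTheory.Automorphic.AutomorphyDatum.gl n K hcpt)), π.1.IsLAlgebraic → (∀ᶠ v : IsDedekindDomain.HeightOneSpectrum (NumberField.RingOfIntegers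 K) in cofinite, ∀ α : Multiset ℂ, π.1.HasSatakeParamAt v α → P.HasSatakeParamAt v (α.map (·⁻¹))) → S K n hcpt π.1 → S K n hcpt P)) → S K n hcpt π.1)
  · refine hsp
      (fun K _ _ n hcpt π => 0 < n → π.W ≤ Literature.NumberTheory.Automorphic.cuspFormsGL n K hcpt → π.IsLAlgebraic → ∀ (ℓ : ℕ) [Fact ℓ.Prime] (ι : PadicAlgCl ℓ ≃+* ℂ), ∃ ρ : Literature.NumberTheory.GaloisRepresentations.FramedGaloisRep K (PadicAlgCl ℓ) n, ρ.toGaloisRep.IsSemisimple ∧ ∀ᶠ v : IsDedekindDomain.HeightOneSpectrum (NumberField.RingOfIntegers K) in cofinite, SatakeFrobCompatibleAt ι π ρ v)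
      ⟨?_, ?_, ?_, ?_, ?_⟩ hn π.2 hπ ℓ ι
    · intro K _ _ n hcpt π hK hn hc hL ℓ _ ι
      exact hAcc K n hcpt hn hK ⟨π, hc⟩ hL ℓ ι
    · intro K₀ _ _ M _ _ _ n h₀ hM h₁ π₀ χ P hπ₀L hχL htw ih hn hPc hPL ℓ _ ι
      obtain ⟨ρ₀, hρ₀ss, hρ₀⟩ := ih hn π₀.2 hπ₀L ℓ ι
      exact hT K₀ M n h₀ hM h₁ hn π₀ χ ⟨P, hPc⟩ hπ₀L hχL hPL htw ℓ ι ρ₀ hρ₀ss hρ₀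
    · intro K _ _ M _ _ _ n hcpt hM π P hPL hBC ih hn hc hπL ℓ _ ι
      obtain ⟨r, hrss, hr⟩ := ih hn P.2 hPL ℓ ι
      exact hD K n hcpt hn ⟨π, hc⟩ hπL M hM P hPL hBC ℓ ι r hrss hr
    · intro K _ _ L _ _ _ m n hL hcpt σ π hm hσL hAI ih hn hc hπL ℓ _ ι
      obtain ⟨r, hrss, hr⟩ := ih hm σ.2 hσL ℓ ι
      exact hI K L m n hL hcpt hm hn σ ⟨π, hc⟩ hσL hπL hAI ℓ ι r hrss hr
    · intro K _ _ n hcpt π P hπL hdual ih hn hc hPL ℓ _ ι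
      obtain ⟨ρ, hρss, hρ⟩ := ih hn π.2 hπL ℓ ι
      exact hV K n hcpt hn π ⟨P, hc⟩ hπL hPL hdual ℓ ι ρ hρss hρ
  · exact hG K n hcpt hn π hπ hsp ℓ ι

end Summit.Langlands.Langlands.Theorems
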